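import Literature.NumberTheory.EllipticCurves.VeluNormProofs
import Mathlib.RingTheory.Polynomial.Resultant.Basic
import Mathlib.Algebra.Polynomial.Lifts
import Mathlib.Algebra.CharP.Quotient
import Mathlib.Algebra.CharP.Lemmas
import HarnessLib

/-!
# Vélu's isogeny by a kernel of canonical type reduces to Frobenius
# (Blakestad–Grant 2023, Prop. 7, by resultants and formal points; proofs only)

Trunk T-NT-EC (Literature/NumberTheory/EllipticCurves). Sequel of `VeluNormProofs.lean`. Let
`y² = f(x) = x³ + Ax + B` be a short Weierstrass curve over an integral domain `𝒪` in which
`p𝒪` is prime (`𝒪/p` a domain; e.g. a complete DVR with uniformizer `p`), `K₀ = Frac 𝒪 ⊆ F` an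
extension field containing the points of a subgroup `G ⊂ E(F)` of odd order `p` and the three
roots `rᵢ` of `f`, and `O ⊆ F` a subring of "integers" of `F` (`O ∩ K₀ = 𝒪`, `pO ∩ 𝒪 = p𝒪`,
`1 + pO ⊆ Oˣ`, `rᵢ ∈ O`). Suppose the kernel polynomial `D = Π_{±u}(X - x(u))` of `G`
satisfies Blakestad–Grant's (4): `φ_ψ := p·D ∈ 𝒪[X]` and `φ_ψ ≡ ℓ₀ (mod p)` for a unit `ℓ₀`
("every elementary symmetric function in the roots of `φ_ψ` lies in `R̂` except for the product,
which lies in `p⁻¹R̂`" — the canonical subgroup). Then (Blakestad–Grant Prop. 7(a),(c)) the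
Vélu quotient `E → E' = E/G`, in the model `E'_p : y_p = yM(x)/φ_ψ(x)³, x_p = U(x)/φ_ψ(x)²`
(`ψ^*ω_p = p·ω`), reduces modulo `p` to the Frobenius:

* `resultant_map_eq_sq_mul_prod`, `sq_mul_veluV_eq_map` — **`p²·V_a = (X - a)·Res_Y(φ_ψ(Y), Q_a(X, Y))`**
  for Blakestad–Grant's quadratic (5) `Q_a` (`veluQaY`): the `e`-degree bookkeeping of their
  proof ("taking the product of (5) over the cosets … `Sᵢ(x) = p²N'(x-rᵢ)(x-rᵢ)^p + pg(x)`")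
  becomes the homogeneity of the resultant, and `resultant_map_of_coeff_eq_zero` /
  `veluTerm_map_eq` give **`V_{rᵢ}/D(rᵢ)² ≡ (X - rᵢ)^p (mod p)`**;
* `three_mul_veluU_eq_map`, `veluThreeU_map_eq` — with the `2`-torsion trick of the prequel
  (`3U = Σᵢ V_{rᵢ}/D(rᵢ)²`): `3U = T^f` with `T ∈ S[X]`, `T ≡ 3X^p (mod p)`; likewise
  `f·M_D² = P^f`, `P ≡ f^p` (`veluF_mul_veluMD_sq_eq_map`, `veluThreeP_map_eq`);
* `exists_map_eq_veluU` — `U` is defined over the field of definition `K₀` of `D`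
  (`D = p⁻¹φ_ψ ∈ K₀[X]`, `V_a = D(a)²U + μ_aD²`);
* **`exists_veluU_lift`, `exists_veluMD_lift`, `exists_veluAB_lift`** (Blakestad–Grant Prop. 7(a)):
  `U`, `M_D`, `a'/p⁴`, `b'/p⁶` come from `U₀, M₀ ∈ 𝒪[X]`, `A₀, B₀ ∈ 𝒪`, with
  **`U₀ ≡ X^p`, `M₀ ≡ f^{(p-1)/2}`, `A₀ℓ₀⁴ ≡ A^p`, `B₀ℓ₀⁶ ≡ B^p (mod p)`** and
  `f·M₀² = U₀³ + A₀U₀φ⁴ + B₀φ⁶` (the model `E'_p`; Blakestad–Grant: `S(x) ≡ x^p`,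
  `M(x) ≡ f(x)^{(p-1)/2}`, `A'_{4,p} ≡ A₄^p/H⁴`, `A'_{6,p} ≡ A₆^p/H⁶`) — `𝒪/p` being a domain,
  the square root `M₀² ≡ f^{p-1} ⇒ M₀ ≡ f^{(p-1)/2}` is taken after descending along the
  injection `𝒪/p ↪ S/(p)`;
* the formal isogeny (`veluFormalIsog`, `veluFormalUnit`): `t_p := -x_p/y_p` at the formal point is
  the power series `t·Φ·u ∈ 𝒪⟦t⟧`, `Φ = t^{p-1}φ_ψ(x(t))`, `u = 𝒰/(X·ℳ)`, with **`u ≡ 1`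
  (`map_veluFormalUnit_sub_one`) and `t_p ≡ ℓ₀·t^p (mod p)` (`map_veluFormalIsog_sub`)** —
  Blakestad–Grant's Prop. 7(c) (`t_p ≡ Ht^p`) and Lemma 12 (`t' = H⁻¹t^pφ_ψ(x)u`, `u ≡ 1`), here
  without the Weierstrass preparation theorem; `coeff_one_veluFormalIsog`: `t_p = pt + ⋯`.

This is step F4b of the programme recorded in `VeluNormProofs.lean` / `PadicSigmaOfZetaProofs.lean`
towards the tree's named fact `WeierstrassCurve.mazur_tate_sigma_existsUnique`
(Mazur–Stein–Tate 2006, Thm. 1.3) along Blakestad–Grant's proof of their Thm. 1.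

## Sources

* C. Blakestad, D. Grant, *On the universal `p`-adic sigma and Weierstrass zeta functions*,
  J. Number Theory 249 (2023) (arXiv:1903.02480), §2.3: Prop. 7 (a)–(c) and its proof
  (eqs. (3)–(6)), Lemma 12. [BlakestadGrant2023]
* J. Vélu, C. R. Acad. Sci. Paris 273 (1971) 238–241. [Velu1971]
* D. Kohel, thesis (Berkeley 1996), §2.4. [Kohel1996]

Pure proof file: the only new data are the explicit bivariate quadratic `veluQaY` and the
explicit power series of the formal isogeny (all with bodies); no named facts.
-/

noncomputable section

open scoped Classical Polynomial.Bivariate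

open Polynomial

namespace Literature.NumberTheory.EllipticCurves

/-! ### Blakestad–Grant's quadratic (5) as a polynomial in `Y = x(u)` -/

section QaY

variable {R : Type*} [CommRing R]

/-- **Blakestad–Grant's (5) in the variable `Y = x(u)`**: the quadratic `Q_a(X, Y) ∈ R[X][Y]`
with `(x - x(u))²·(x(P+u) - a)(x(P-u) - a) = Q_a(x, x(u))`, for `y² = x³ + Ax + B`:
`Q_a = (X - a)²Y² - 2(aX² + (A + a²)X + aA + 2B)·Y + (a²X² - (2aA + 4B)X + A² - 4aB)`.
[Blakestad–Grant 2023, eq. (5) ("`L_{i,1}(x(u))`, `L_{i,2}(x(u))` are polynomials of degree 1 in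
`x(u)`" — in fact `Q_a` is quadratic in `x(u)` with leading coefficient `(x - a)²`)]
[cite: BlakestadGrant2023, Prop. 7] -/
def veluQaY (A B a : R) : R[X][Y] :=
  Polynomial.C ((X - C a) ^ 2) * Y ^ 2 -
    Polynomial.C (2 * (C a * X ^ 2 + C (A + a ^ 2) * X + C (a * A + 2 * B))) * Y +
      Polynomial.C (C (a ^ 2) * X ^ 2 - C (2 * a * A + 4 * B) * X + C (A ^ 2 - 4 * a * B))

/-- `deg_Y Q_a ≤ 2`. [folklore] -/
theorem natDegree_veluQaY_le (A B a : R) : (veluQaY A B a).natDegree ≤ 2 := by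
  unfold veluQaY
  refine (natDegree_add_le _ _).trans (max_le ((natDegree_sub_le _ _).trans (max_le ?_ ?_)) ?_)
  · exact (natDegree_C_mul_le _ _).trans (natDegree_pow_le_of_le 2 natDegree_X_le)
  · exact (natDegree_C_mul_le _ _).trans (natDegree_X_le.trans (by norm_num))
  · rw [natDegree_C]; exact Nat.zero_le _

/-- `[Y²] Q_a = (X - a)²`. [folklore] -/
theorem coeff_veluQaY_two (A B a : R) : (veluQaY A B a).coeff 2 = (X - C a) ^ 2 := by
  unfold veluQaY
  rw [coeff_add, coeff_sub, coeff_C_mul, coeff_C_mul, coeff_C, coeff_X_pow, coeff_X]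
  simp

/-- `Q_a` commutes with ring maps. [folklore] -/
theorem map_veluQaY {S : Type*} [CommRing S] (f : R →+* S) (A B a : R) :
    (veluQaY A B a).map (mapRingHom f) = veluQaY (f A) (f B) (f a) := by
  unfold veluQaY
  simp only [Polynomial.map_add, Polynomial.map_sub, Polynomial.map_mul, Polynomial.map_pow, map_C,
    map_X, coe_mapRingHom, Polynomial.map_ofNat, map_add, map_sub, map_mul, map_pow, map_ofNat]

/-- `Q_a(X, c)` written out: `(c - a)²X² - 2((a + c)(A + ac) + 2B)X + ((A - ac)² - 4B(a + c))`
(the `veluQa` of `VeluNormProofs.lean`). [folklore] -/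
theorem eval_veluQaY_C (A B a c : R) : (veluQaY A B a).eval (C c) =
    C ((c - a) ^ 2) * X ^ 2 - C (2 * ((a + c) * (A + a * c) + 2 * B)) * X +
      C ((A - a * c) ^ 2 - 4 * B * (a + c)) := by
  unfold veluQaY
  simp only [eval_add, eval_sub, eval_mul, eval_pow, eval_C, eval_X, eval_ofNat, map_add, map_sub, map_mul,
    map_pow, map_ofNat]
  ring

/-- **The resultant modulo `p`**: if all coefficients of `φ` of positive degree die under
`π : S → k` then `π(Res_Y(φ(Y), Q(Y))) = π(φ₀)²·([Y²]Q̄)^m` (formal degrees `(m, 2)`): the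
resultant of a CONSTANT `ℓ₀` against a quadratic is `ℓ₀²·(leading coefficient)^m`.
[Blakestad–Grant 2023, proof of Prop. 7 ("every elementary symmetric function in the roots of
`φ_ψ(x)` lies in `R̂` except for the product … `Sᵢ(x) = p²N'(x - rᵢ)(x - rᵢ)^p + pg(x)`")]
[folklore] -/
theorem resultant_map_of_coeff_eq_zero {S k : Type*} [CommRing S] [CommRing k] (π : S →+* k)
    (φ : S[X]) (Q : S[X][Y]) (m : ℕ) (hφ : ∀ i, 1 ≤ i → π (φ.coeff i) = 0) :
    (Polynomial.resultant (φ.map C) Q m 2).map π =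
      C (π (φ.coeff 0) ^ 2) * ((Q.map (mapRingHom π)).coeff 2) ^ m := by
  rw [← coe_mapRingHom, ← Polynomial.resultant_map_map, Polynomial.map_map]
  have hcomm : (mapRingHom π).comp (C : S →+* S[X]) = (C : k →+* k[X]).comp π := by
    ext s; simp
  have hφπ : φ.map π = C (π (φ.coeff 0)) := by
    ext i
    rw [coeff_map, coeff_C]
    split_ifs with hi
    · rw [hi]
    · exact hφ i (Nat.one_le_iff_ne_zero.mpr hi)
  rw [hcomm, ← Polynomial.map_map, hφπ, map_C, Polynomial.resultant_C_left, mul_comm m 2, pow_mul, neg_one_sq,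
    one_pow, one_mul, ← map_pow, mul_comm]

/-- The resultant congruence for `Q_a`: `π(Res_Y(φ, Q_a)) = π(φ₀)²·(X - π a)^{2m}`.
[Blakestad–Grant 2023, proof of Prop. 7 (`Sᵢ(x) ≡ p²N'(x - rᵢ)(x - rᵢ)^p (mod p)`)]
[cite: BlakestadGrant2023, Prop. 7] -/
theorem resultant_veluQaY_map_eq {S k : Type*} [CommRing S] [CommRing k] (π : S →+* k) (φ : S[X])
    (hφ : ∀ i, 1 ≤ i → π (φ.coeff i) = 0) (A B a : S) (m : ℕ) :
    (Polynomial.resultant (φ.map C) (veluQaY A B a) m 2).map π =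
      C (π (φ.coeff 0) ^ 2) * (X - C (π a)) ^ (2 * m) := by
  rw [resultant_map_of_coeff_eq_zero π φ _ m hφ, map_veluQaY, coeff_veluQaY_two, ← pow_mul]

end QaY

end Literature.NumberTheory.EllipticCurves

/-! ### `p²·V_a = (X - a)·Res_Y(φ_ψ, Q_a)` -/

namespace WeierstrassCurve.Affine.Point

open Literature.NumberTheory.EllipticCurves

section Resultant

variable {K : Type*} [Field K] {W : WeierstrassCurve K} {G : Finset W.toAffine.Point}

/-- `Q_a(X, c)` is the `q_{a,c}` of the prequel. [folklore] -/
theorem eval_veluQaY_eq_veluQa (a c : K) : (veluQaY W.a₄ W.a₆ a).eval (C c) = veluQa W a c := by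
  rw [eval_veluQaY_C]; rfl

variable (G) in
/-- `D(Y) = Π_c (Y - c)` over `K[X]`. [folklore] -/
theorem veluD_map_C : (veluD G).map (C : K →+* K[X]) = ∏ c ∈ veluXVals G, (Y - C (C c)) := by
  rw [veluD, Polynomial.map_prod]
  exact Finset.prod_congr rfl fun c _ => by rw [Polynomial.map_sub, map_X, map_C]

variable (G) in
/-- **`Res_Y(D(Y), Q_a(X, Y)) = Π_c q_{a,c}(X)`** (product over the roots of the monic split `D`).
[folklore] -/
theorem resultant_veluD_map_C (a : K) :
    Polynomial.resultant ((veluD G).map C) (veluQaY W.a₄ W.a₆ a) (veluXVals G).card 2 =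
      ∏ c ∈ veluXVals G, veluQa W a c := by
  have hprod : (veluD G).map (C : K →+* K[X]) = ∏ b ∈ (veluXVals G).image (C : K →+* K[X]), (Y - C b) := by
    rw [veluD_map_C, Finset.prod_image fun a _ b _ h => C_injective h]
  have hsplit : ((veluD G).map (C : K →+* K[X])).Splits := by
    rw [veluD_map_C]; exact Splits.prod fun c _ => Splits.X_sub_C _
  have hdeg : ((veluD G).map (C : K →+* K[X])).natDegree = (veluXVals G).card := by
    rw [natDegree_map_eq_of_injective C_injective, natDegree_veluD]
  have h := Polynomial.resultant_eq_prod_eval ((veluD G).map C) (veluQaY W.a₄ W.a₆ a) 2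
    (natDegree_veluQaY_le _ _ _) hsplit
  rw [hdeg, leadingCoeff_map_of_injective C_injective, (monic_veluD G).leadingCoeff, map_one, one_pow,
    one_mul] at h
  rw [h, hprod, roots_prod_X_sub_C, ← Finset.prod_eq_multiset_prod,
    Finset.prod_image fun a _ b _ h => C_injective h]
  exact Finset.prod_congr rfl fun c _ => eval_veluQaY_eq_veluQa a c

/-- **`κ²·V_a` is the image of `(X - a)·Res_Y(D_S(Y), Q_a(X, Y))`** computed over any ring `S`
mapping to `K` in which `κ·D` and `a` are defined (`κ = p`, `D_S = φ_ψ` over the integers `O`;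
`κ = 1`, `D_S = D` over the field of definition `K₀`). [Blakestad–Grant 2023, proof of Prop. 7
(`N(x - rᵢ) = Sᵢ(x)/φ_ψ(x)²`, `Sᵢ ∈ R̂[rᵢ][x]`)] [cite: BlakestadGrant2023, Prop. 7] -/
theorem resultant_map_eq_sq_mul_prod {S : Type*} [CommRing S] (f : S →+* K) {DS : S[X]} {κ : K}
    (hD : DS.map f = C κ * veluD G) {A B : S} (hA : f A = W.a₄) (hB : f B = W.a₆) (a : S) :
    (Polynomial.resultant (DS.map C) (veluQaY A B a) (veluXVals G).card 2).map f =
      C (κ ^ 2) * ∏ c ∈ veluXVals G, veluQa W (f a) c := by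
  rw [← coe_mapRingHom, ← Polynomial.resultant_map_map, map_veluQaY, Polynomial.map_map]
  have hcomm : (mapRingHom f).comp (C : S →+* S[X]) = (C : K →+* K[X]).comp f := by ext s; simp
  rw [hcomm, ← Polynomial.map_map, hD, Polynomial.map_mul, map_C, Polynomial.resultant_C_mul_left, hA, hB,
    resultant_veluD_map_C, map_pow]

/-- **`κ²·V_a = ((X - a)·Res_Y(D_S, Q_a))^f`**. [Blakestad–Grant 2023, proof of Prop. 7]
[cite: BlakestadGrant2023, Prop. 7] -/
theorem sq_mul_veluV_eq_map {S : Type*} [CommRing S] (f : S →+* K) {DS : S[X]} {κ : K}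
    (hD : DS.map f = C κ * veluD G) {A B : S} (hA : f A = W.a₄) (hB : f B = W.a₆) (a : S) :
    C (κ ^ 2) * veluV G (f a) =
      ((X - C a) * Polynomial.resultant (DS.map C) (veluQaY A B a) (veluXVals G).card 2).map f := by
  rw [Polynomial.map_mul, resultant_map_eq_sq_mul_prod f hD hA hB, Polynomial.map_sub, map_X, map_C, veluV]
  ring

/-- `(D_S)^f(f s) = κ·D(f s)`. [folklore] -/
theorem map_eval_eq {S : Type*} [CommRing S] (f : S →+* K) {DS : S[X]} {κ : K}
    (hD : DS.map f = C κ * veluD G) (s : S) : f (DS.eval s) = κ * (veluD G).eval (f s) := by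
  rw [← eval₂_hom, ← eval_map, hD, eval_mul, eval_C]

end Resultant

end WeierstrassCurve.Affine.Point

/-! ### The `2`-torsion combination: `3U = T^f` with `T ≡ 3X^p` -/

namespace WeierstrassCurve

open Literature.NumberTheory.EllipticCurves Affine Affine.Point

section ThreeRoots

variable {F : Type*} [Field F] [CharZero F] {W : WeierstrassCurve F} [W.IsShortNF] [W.IsElliptic]
  {G : Finset (W⁄F).toAffine.Point}

variable {S : Type*} [CommRing S] (f : S →+* F)

omit [CharZero F] [W.IsShortNF] [W.IsElliptic] in
/-- **`V_{rᵢ}/D(rᵢ)² = (uᵢ⁻²·(X - sᵢ)·Res_Y(φ, Q_{sᵢ}))^f`** for a root `rᵢ = f(sᵢ)` with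
`uᵢ = φ(sᵢ)` a unit (`φ^f = κ·D`). [Blakestad–Grant 2023, proof of Prop. 7
(`cᵢ² = 1/(p²N'(x - rᵢ)) = 1/φ_ψ(rᵢ)²`)] [cite: BlakestadGrant2023, Prop. 7] -/
theorem inv_sq_mul_veluV_eq_map {φS : S[X]} {κ : F} (hκ : κ ≠ 0) (hD : φS.map f = C κ * veluD G)
    {A B : S} (hA : f A = W.a₄) (hB : f B = W.a₆) (s : S) (u : Sˣ) (hu : (u : S) = φS.eval s) :
    C ((veluD G).eval (f s) ^ 2)⁻¹ * veluV G (f s) =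
      (C ((↑u⁻¹ : S) ^ 2) * ((X - C s) * Polynomial.resultant (φS.map C) (veluQaY A B s)
        (veluXVals G).card 2)).map f := by
  have hA' : f A = (W⁄F).a₄ := hA
  have hB' : f B = (W⁄F).a₆ := hB
  have he := map_eval_eq f hD s
  rw [← hu] at he
  have hui : f (↑u⁻¹ : S) * f u = 1 := by rw [← map_mul, Units.inv_mul, map_one]
  have hfu : f u ≠ 0 := fun h0 => by rw [h0, mul_zero] at hui; exact zero_ne_one hui
  have hinv : f (↑u⁻¹ : S) = (f u)⁻¹ := eq_inv_of_mul_eq_one_left hui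
  have hDi : (veluD G).eval (f s) = κ⁻¹ * f u := by
    rw [he]; field_simp
  have hscal : ((veluD G).eval (f s) ^ 2)⁻¹ = f ((↑u⁻¹ : S) ^ 2) * κ ^ 2 := by
    rw [hDi, map_pow, hinv]; field_simp
  rw [Polynomial.map_mul, map_C, ← sq_mul_veluV_eq_map f hD hA' hB', hscal, C_mul, mul_assoc]

omit [CharZero F] [W.IsShortNF] [W.IsElliptic] in
/-- `uᵢ = φ(sᵢ) ≡ φ₀ (mod ker π)` when the higher coefficients of `φ` die under `π`. [folklore] -/
theorem map_eval_eq_map_coeff_zero {k : Type*} [CommRing k] (π : S →+* k) {φS : S[X]}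
    (hφ : ∀ i, 1 ≤ i → π (φS.coeff i) = 0) (s : S) : π (φS.eval s) = π (φS.coeff 0) := by
  rw [eval_eq_sum_range, map_sum, Finset.sum_eq_single_of_mem 0 (Finset.mem_range.mpr (Nat.succ_pos _))]
  · rw [pow_zero, mul_one]
  · intro i _ hi
    rw [map_mul, hφ i (Nat.one_le_iff_ne_zero.mpr hi), zero_mul]

omit [CharZero F] [W.IsShortNF] [W.IsElliptic] in
/-- **Each term reduces to `(X - sᵢ)^p`**: under `π : S → k` killing the higher coefficients of
`φ`, `(uᵢ⁻²(X - sᵢ)Res_Y(φ, Q_{sᵢ}))^π = (X - π sᵢ)^{2m+1}` (`uᵢ ≡ φ₀`).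
[Blakestad–Grant 2023, proof of Prop. 7 (`Sᵢ ≡ p²N'(x - rᵢ)(x - rᵢ)^p`, `p²N'(x - rᵢ) =
φ_ψ(rᵢ)² ≡ ℓ̃₀²`)] [cite: BlakestadGrant2023, Prop. 7] -/
theorem veluTerm_map_eq {k : Type*} [CommRing k] (π : S →+* k) {φS : S[X]}
    (hφ : ∀ i, 1 ≤ i → π (φS.coeff i) = 0) (A B s : S) (u : Sˣ) (hu : (u : S) = φS.eval s) (m : ℕ) :
    (C ((↑u⁻¹ : S) ^ 2) * ((X - C s) * Polynomial.resultant (φS.map C) (veluQaY A B s) m 2)).map π =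
      (X - C (π s)) ^ (2 * m + 1) := by
  have hui : π (↑u⁻¹ : S) * π (φS.coeff 0) = 1 := by
    rw [← map_eval_eq_map_coeff_zero π hφ s, ← hu, ← map_mul, Units.inv_mul, map_one]
  have hsc : C (π ((↑u⁻¹ : S) ^ 2)) * C (π (φS.coeff 0) ^ 2) = 1 := by
    rw [map_pow, ← C_mul, ← mul_pow, hui, one_pow, C_1]
  rw [Polynomial.map_mul, Polynomial.map_mul, resultant_veluQaY_map_eq π φS hφ, map_C, Polynomial.map_sub,
    map_X, map_C, pow_succ' (X - C (π s)) (2 * m)]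
  linear_combination (X - C (π s)) * (X - C (π s)) ^ (2 * m) * hsc

/-- The combination `T = Σᵢ C(uᵢ⁻²)·(X - sᵢ)·Res_Y(φ(Y), Q_{sᵢ}(X, Y)) ∈ S[X]` whose image is
`3U` (`uᵢ = φ(sᵢ)`, `rᵢ = f(sᵢ)` the roots of `f`). [Blakestad–Grant 2023, proof of Prop. 7
(`x_p = ⅓ Σᵢ Sᵢ(x)/(φ_ψ(rᵢ)²φ_ψ(x)²)`)] [cite: BlakestadGrant2023, Prop. 7] -/
def veluThreeU (φS : S[X]) (A B : S) (s : Fin 3 → S) (u : Fin 3 → Sˣ) (m : ℕ) : S[X] :=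
  ∑ i : Fin 3, C ((↑(u i)⁻¹ : S) ^ 2) * ((X - C (s i)) * Polynomial.resultant (φS.map C) (veluQaY A B (s i)) m 2)

/-- The product `P = Πᵢ C(uᵢ⁻²)·(X - sᵢ)·Res_Y(φ(Y), Q_{sᵢ}(X, Y)) ∈ S[X]` whose image is `f·M_D²`.
[Blakestad–Grant 2023, proof of Prop. 7 (`y_p² = Πᵢ Sᵢ(x)/(φ_ψ(rᵢ)²φ_ψ(x)²)`)]
[cite: BlakestadGrant2023, Prop. 7] -/
def veluThreeP (φS : S[X]) (A B : S) (s : Fin 3 → S) (u : Fin 3 → Sˣ) (m : ℕ) : S[X] :=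
  ∏ i : Fin 3, C ((↑(u i)⁻¹ : S) ^ 2) * ((X - C (s i)) * Polynomial.resultant (φS.map C) (veluQaY A B (s i)) m 2)

/-- **`3U = T^f`**: with `φ^f = κ·D`, `rᵢ = f(sᵢ)` the three roots of `f` and `uᵢ = φ(sᵢ)` units,
`3U` is the image of `veluThreeU`. [Blakestad–Grant 2023, proof of Prop. 7 (`x_p = ⅓Σcᵢ²N(x - rᵢ)`
with `cᵢ² = 1/φ_ψ(rᵢ)²`)] [cite: BlakestadGrant2023, Prop. 7] -/
theorem three_mul_veluU_eq_map (hG : IsOddSubgroupFinset G) {φS : S[X]} {κ : F} (hκ : κ ≠ 0)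
    (hD : φS.map f = C κ * veluD G) {A B : S} (hA : f A = W.a₄) (hB : f B = W.a₆) {s : Fin 3 → S}
    (hf : veluF (W⁄F) = (X - C (f (s 0))) * (X - C (f (s 1))) * (X - C (f (s 2))))
    (u : Fin 3 → Sˣ) (hu : ∀ i, (u i : S) = φS.eval (s i)) :
    3 * veluU G = (veluThreeU φS A B s u (veluXVals G).card).map f := by
  rw [← three_mul_veluU_eq hG hf, veluThreeU, Polynomial.map_sum, Fin.sum_univ_three,
    ← inv_sq_mul_veluV_eq_map f hκ hD hA hB (s 0) (u 0) (hu 0),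
    ← inv_sq_mul_veluV_eq_map f hκ hD hA hB (s 1) (u 1) (hu 1),
    ← inv_sq_mul_veluV_eq_map f hκ hD hA hB (s 2) (u 2) (hu 2)]

/-- **`f·M_D² = P^f`** (`veluF_mul_veluMD_sq_eq_prod` read over `S`). [Blakestad–Grant 2023,
proof of Prop. 7] [cite: BlakestadGrant2023, Prop. 7] -/
theorem veluF_mul_veluMD_sq_eq_map (hG : IsOddSubgroupFinset G) {φS : S[X]} {κ : F} (hκ : κ ≠ 0)
    (hD : φS.map f = C κ * veluD G) {A B : S} (hA : f A = W.a₄) (hB : f B = W.a₆) {s : Fin 3 → S}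
    (hf : veluF (W⁄F) = (X - C (f (s 0))) * (X - C (f (s 1))) * (X - C (f (s 2))))
    (u : Fin 3 → Sˣ) (hu : ∀ i, (u i : S) = φS.eval (s i)) :
    veluF (W⁄F) * veluMD G ^ 2 = (veluThreeP φS A B s u (veluXVals G).card).map f := by
  rw [veluF_mul_veluMD_sq_eq_prod hG hf, veluThreeP, Polynomial.map_prod, Fin.prod_univ_three,
    ← inv_sq_mul_veluV_eq_map f hκ hD hA hB (s 0) (u 0) (hu 0),
    ← inv_sq_mul_veluV_eq_map f hκ hD hA hB (s 1) (u 1) (hu 1),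
    ← inv_sq_mul_veluV_eq_map f hκ hD hA hB (s 2) (u 2) (hu 2)]

omit [CharZero F] [W.IsShortNF] [W.IsElliptic] in
/-- **`T ≡ 3X^p (mod p)`**: under `π : S → k` of characteristic `p = 2m + 1` killing the higher
coefficients of `φ`, with `s₀ + s₁ + s₂ = 0` (the roots of a short cubic), the image of
`veluThreeU` is `Σᵢ (X - sᵢ)^p = 3X^p - (Σᵢ sᵢ)^p = 3X^p`. [Blakestad–Grant 2023, proof of
Prop. 7 ("`S(x) … reduces to `x^p` mod `p`")] [cite: BlakestadGrant2023, Prop. 7] -/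
theorem veluThreeU_map_eq {k : Type*} [CommRing k] (π : S →+* k) {p : ℕ} [hp : Fact p.Prime] [CharP k p]
    {φS : S[X]} (hφ : ∀ i, 1 ≤ i → π (φS.coeff i) = 0) (A B : S) {s : Fin 3 → S}
    (hs : s 0 + s 1 + s 2 = 0) (u : Fin 3 → Sˣ) (hu : ∀ i, (u i : S) = φS.eval (s i)) {m : ℕ}
    (hm : 2 * m + 1 = p) :
    (veluThreeU φS A B s u m).map π = 3 * X ^ p := by
  have hk : π (s 0) ^ p + π (s 1) ^ p + π (s 2) ^ p = 0 := by
    rw [← add_pow_char, ← add_pow_char, ← map_add, ← map_add, hs, _root_.map_zero, zero_pow hp.out.ne_zero]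
  have hC : C (π (s 0) ^ p) + C (π (s 1) ^ p) + C (π (s 2) ^ p) = (0 : k[X]) := by
    rw [← C_add, ← C_add, hk, C_0]
  rw [veluThreeU, Polynomial.map_sum, Fin.sum_univ_three, veluTerm_map_eq π hφ A B (s 0) (u 0) (hu 0),
    veluTerm_map_eq π hφ A B (s 1) (u 1) (hu 1), veluTerm_map_eq π hφ A B (s 2) (u 2) (hu 2), hm, sub_pow_char,
    sub_pow_char, sub_pow_char, ← C_pow, ← C_pow, ← C_pow]
  linear_combination -hC

omit [CharZero F] [W.IsShortNF] [W.IsElliptic] in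
/-- **`P ≡ (Πᵢ(X - sᵢ))^p = f^p (mod p)`**. [Blakestad–Grant 2023, proof of Prop. 7
("`M(x) ≡ f(x)^{(p-1)/2} mod p`")] [cite: BlakestadGrant2023, Prop. 7] -/
theorem veluThreeP_map_eq {k : Type*} [CommRing k] (π : S →+* k) {p : ℕ}
    {φS : S[X]} (hφ : ∀ i, 1 ≤ i → π (φS.coeff i) = 0) (A B : S) (s : Fin 3 → S)
    (u : Fin 3 → Sˣ) (hu : ∀ i, (u i : S) = φS.eval (s i)) {m : ℕ} (hm : 2 * m + 1 = p) :
    (veluThreeP φS A B s u m).map π = (((X - C (s 0)) * (X - C (s 1)) * (X - C (s 2))).map π) ^ p := by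
  rw [veluThreeP, Polynomial.map_prod, Fin.prod_univ_three, veluTerm_map_eq π hφ A B (s 0) (u 0) (hu 0),
    veluTerm_map_eq π hφ A B (s 1) (u 1) (hu 1), veluTerm_map_eq π hφ A B (s 2) (u 2) (hu 2), hm,
    Polynomial.map_mul, Polynomial.map_mul, Polynomial.map_sub, Polynomial.map_sub, Polynomial.map_sub, map_X,
    map_C, map_C, map_C, ← mul_pow, ← mul_pow]

end ThreeRoots

/-! ### Descent of `U` to the field of definition `K₀` of `D` -/

section Descent

variable {F : Type*} [Field F] [CharZero F] (W : WeierstrassCurve F) [W.IsShortNF] [W.IsElliptic]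
  {G : Finset (W⁄F).toAffine.Point}

omit [W.IsShortNF] [W.IsElliptic] in
/-- Some natural number `a ≤ n` is not a root of `D` (`deg D = n`, and `ℕ ↪ F`). [folklore] -/
theorem exists_nat_eval_veluD_ne_zero : ∃ a : ℕ, (veluD G).eval (a : F) ≠ 0 := by
  by_contra h
  push Not at h
  set n := (veluXVals G).card
  have hsub : (Finset.range (n + 1)).image (Nat.cast : ℕ → F) ⊆ (veluD G).roots.toFinset := by
    intro x hx
    obtain ⟨a, -, rfl⟩ := Finset.mem_image.mp hx
    exact Multiset.mem_toFinset.mpr ((mem_roots (veluD_ne_zero G)).mpr (h a))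
  have h1 := Finset.card_le_card hsub
  rw [Finset.card_image_of_injective _ Nat.cast_injective, Finset.card_range] at h1
  have h2 := (Multiset.toFinset_card_le (veluD G).roots).trans ((card_roots' _).trans (natDegree_veluD G).le)
  omega

variable {K₀ : Type*} [Field K₀] (ι₀ : K₀ →+* F)

omit [CharZero F] [W.IsShortNF] [W.IsElliptic] in
/-- `[X^{2n}] U = [X^{2n-1}] P₂` (`U = XP₂ + U₁`, `deg U₁ ≤ 2n - 1`). [folklore] -/
theorem coeff_veluU_two_mul (hG : IsOddSubgroupFinset G) (hn : 1 ≤ (veluXVals G).card) :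
    (veluU G).coeff (2 * (veluXVals G).card) = (veluP₂ G).coeff (2 * (veluXVals G).card - 1) := by
  set n := (veluXVals G).card with hndef
  have h2n : 2 * n = (2 * n - 1) + 1 := by omega
  rw [veluU, coeff_add, h2n, coeff_X_mul, ← h2n,
    coeff_eq_zero_of_natDegree_lt ((natDegree_veluU₁_le hG).trans_lt (by rw [card_erase_zero_eq hG, ← hndef]; omega)),
    add_zero]

/-- **`U` is defined over `K₀`**: if `D` (hence `P₂ = D²`) and the curve come from a subfield
`K₀` then so does Vélu's numerator `U` — from `V_a = D(a)²U + μ_aD²` (`veluV_eq`) at an integer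
`a` with `D(a) ≠ 0`, where `V_a = (X - a)Res_Y(D, Q_a)` and `μ_a = [X^{2n}]V_a - D(a)²[X^{2n-1}]D²`
lie over `K₀`. [Blakestad–Grant 2023, Prop. 7 (the coefficients of `S(x)` lie in the base);
Vélu 1971 (rationality of the formulae)] [cite: BlakestadGrant2023, Prop. 7] -/
theorem exists_map_eq_veluU (hG : IsOddSubgroupFinset G) (hn : 1 ≤ (veluXVals G).card) {DK : K₀[X]}
    (hD : DK.map ι₀ = veluD G) {A B : K₀} (hA : ι₀ A = W.a₄) (hB : ι₀ B = W.a₆) :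
    ∃ UK : K₀[X], UK.map ι₀ = veluU G := by
  obtain ⟨a, ha⟩ := exists_nat_eval_veluD_ne_zero W (G := G)
  set n := (veluXVals G).card with hndef
  have hA' : ι₀ A = (W⁄F).a₄ := hA
  have hB' : ι₀ B = (W⁄F).a₆ := hB
  have hD1 : DK.map ι₀ = C 1 * veluD G := by rw [map_one, one_mul, hD]
  have hV := sq_mul_veluV_eq_map ι₀ hD1 hA' hB' (a : K₀)
  rw [one_pow, map_one, one_mul, map_natCast] at hV
  set VK := (X - C (a : K₀)) * Polynomial.resultant (DK.map C) (veluQaY A B (a : K₀)) n 2 with hVK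
  have hDa : (veluD G).eval (a : F) = ι₀ (DK.eval (a : K₀)) := by
    rw [← hD, eval_map, ← map_natCast ι₀ a, eval₂_hom]
  have hP₂ : veluP₂ G = (DK ^ 2).map ι₀ := by rw [veluP₂_eq_veluD_sq hG, Polynomial.map_pow, hD]
  set μK := VK.coeff (2 * n) - DK.eval (a : K₀) ^ 2 * (DK ^ 2).coeff (2 * n - 1) with hμK
  have hμ : veluMu G (a : F) = ι₀ μK := by
    rw [veluMu, coeff_sub, coeff_C_mul, coeff_veluU_two_mul W hG hn, hP₂, coeff_map, hDa, hV, coeff_map, hμK,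
      map_sub, map_mul, map_pow]
  have hE := W.veluV_eq hG (a : F)
  rw [hV, hμ, hDa, ← map_pow, ← hD, ← Polynomial.map_pow, ← Polynomial.map_C ι₀, ← Polynomial.map_C ι₀,
    ← Polynomial.map_mul] at hE
  refine ⟨C (DK.eval (a : K₀) ^ 2)⁻¹ * (VK - C μK * DK ^ 2), ?_⟩
  have hDa0 : ι₀ (DK.eval (a : K₀) ^ 2) ≠ 0 := by rw [map_pow, ← hDa]; exact pow_ne_zero 2 ha
  rw [Polynomial.map_mul, Polynomial.map_C, map_inv₀, Polynomial.map_sub, hE, Polynomial.map_C]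
  rw [add_sub_cancel_right, ← mul_assoc, ← C_mul, inv_mul_cancel₀ hDa0, C_1, one_mul]

/-- **A polynomial with coefficients in `j(R)` after multiplication by a `j(R)`-polynomial with unit
constant term already has coefficients in `j(R)`** (`T = E·Q⁻¹` in `R⟦X⟧`). This is the
power-series form of "Gauss's lemma" used by Blakestad–Grant for (6) (`A'S + B'φ² ∈ R̂[x]`
because `φ⁴` has unit constant term). [Blakestad–Grant 2023, proof of Prop. 7 ("since the
constant term of `φ_ψ(x)` is a unit in `R̂`, Gauss's lemma gives (6)")] [folklore] -/
theorem mem_lifts_of_mul_eq_map {R K : Type*} [CommRing R] [CommRing K] (j : R →+* K) {T : K[X]}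
    {E₀ Q₀ : R[X]} (hE : T * Q₀.map j = E₀.map j) (u₀ : Rˣ) (hu : Q₀.coeff 0 = u₀) : T ∈ lifts j := by
  rw [lifts_iff_coeff_lifts]
  intro k
  -- in `K⟦X⟧`: `T = E·(Q⁻¹)` with `Q⁻¹` the image of the `R`-inverse of `Q₀`
  set Inv : PowerSeries R := PowerSeries.invOfUnit (Q₀ : PowerSeries R) u₀ with hInv
  have hQInv : (Q₀ : PowerSeries R) * Inv = 1 :=
    PowerSeries.mul_invOfUnit _ _ (by rw [Polynomial.constantCoeff_coe, hu])
  have hcoe : ∀ P : R[X], ((P.map j : K[X]) : PowerSeries K) = PowerSeries.map j (P : PowerSeries R) := by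
    intro P; ext i; rw [Polynomial.coeff_coe, PowerSeries.coeff_map, Polynomial.coeff_coe, Polynomial.coeff_map]
  have hT : (T : PowerSeries K) = PowerSeries.map j ((E₀ : PowerSeries R) * Inv) := by
    have h1 : (T : PowerSeries K) * PowerSeries.map j ((Q₀ : PowerSeries R) * Inv) = (T : PowerSeries K) := by
      rw [hQInv, _root_.map_one, mul_one]
    rw [← h1, map_mul, ← mul_assoc, ← hcoe, ← Polynomial.coe_mul, hE, hcoe, ← map_mul]
  refine ⟨PowerSeries.coeff k ((E₀ : PowerSeries R) * Inv), ?_⟩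
  rw [← Polynomial.coeff_coe, hT, PowerSeries.coeff_map]

end Descent

/-! ### Integrality over `𝒪` and the congruence `U ≡ X^p` (Blakestad–Grant Prop. 7(a): `S ≡ x^p`) -/

section Integral

variable {F : Type*} [Field F] [CharZero F] (W : WeierstrassCurve F) [W.IsShortNF] [W.IsElliptic]
  {G : Finset (W⁄F).toAffine.Point}
variable {K₀ : Type*} [Field K₀] (ι₀ : K₀ →+* F)
variable {𝒪 : Type*} [CommRing 𝒪] (j : 𝒪 →+* K₀)
variable {S : Type*} [CommRing S] (f : S →+* F) (ι : 𝒪 →+* S)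
variable {k : Type*} [CommRing k] (π : S →+* k) {p : ℕ} [hp : Fact p.Prime]

omit [CharZero F] [W.IsShortNF] [W.IsElliptic] in
/-- The roots of the short cubic `f = (X - r₀)(X - r₁)(X - r₂)` sum to zero. [folklore] -/
theorem sum_roots_eq_zero {r : Fin 3 → F}
    (hfac : veluF (W⁄F) = (X - C (r 0)) * (X - C (r 1)) * (X - C (r 2))) : r 0 + r 1 + r 2 = 0 := by
  rw [X_sub_C_mul_three, veluF] at hfac
  have h := congrArg (Polynomial.coeff · 2) hfac
  simp only [coeff_add, coeff_sub, coeff_C_mul, coeff_X_pow, coeff_X, coeff_C] at h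
  norm_num at h
  linear_combination h

omit hp in
/-- Coefficients of positive degree of `φ^ι` die modulo `p` when `p` divides them in `𝒪`.
[folklore] -/
theorem map_coeff_map_eq_zero [CharP k p] {φO : 𝒪[X]} (hφ1 : ∀ i, 1 ≤ i → (p : 𝒪) ∣ φO.coeff i) :
    ∀ i, 1 ≤ i → π ((φO.map ι).coeff i) = 0 := by
  intro i hi
  obtain ⟨c, hc⟩ := hφ1 i hi
  rw [coeff_map, hc, map_mul, map_mul, map_natCast, map_natCast, CharP.cast_eq_zero, zero_mul]

/-- **`U ∈ 𝒪[X]` and `U ≡ X^p (mod p)`** (Blakestad–Grant Prop. 7(a): "`x_p = S(x)/φ_ψ(x)²` for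
some polynomial `S(x) ∈ R̂[x]` of degree `p` which reduces to `x^p` mod `p`"; here `S = U`).
Setting: `𝒪 →ʲ K₀ →^{ι₀} F` and `𝒪 →^ι S →ᶠ F` commute, `f` injective, `K₀ ∩ f(S) ⊆ j(𝒪)`
(`hOK`), `ι⁻¹(ker π) ⊆ p𝒪` (`hker`) for `π : S → k` of characteristic `p`, `3 ∈ 𝒪ˣ`;
`φ^{ι₀j} = p·D` with `p ∣ φᵢ` (`i ≥ 1`); the roots of `f` are `f(sᵢ)` and `uᵢ = φ(sᵢ) ∈ Sˣ`;
`#G = p`. Proof: `U` is defined over `K₀` (`exists_map_eq_veluU`), `3U = T^f` with `T ∈ S[X]`,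
`T ≡ 3X^p` (`three_mul_veluU_eq_map`, `veluThreeU_map_eq`), and the two descriptions are glued
along `hOK`, `hker`. [Blakestad–Grant 2023, Prop. 7(a)] [cite: BlakestadGrant2023, Prop. 7] -/
theorem exists_veluU_lift [CharP k p] (hG : IsOddSubgroupFinset G) (hcomm : f.comp ι = ι₀.comp j)
    (hfi : Function.Injective f) (hOK : ∀ x : K₀, ι₀ x ∈ Set.range f → x ∈ Set.range j)
    (hker : ∀ c : 𝒪, π (ι c) = 0 → (p : 𝒪) ∣ c) (h3 : IsUnit (3 : 𝒪))
    {φO : 𝒪[X]} (hφF : φO.map (ι₀.comp j) = C (p : F) * veluD G) (hφ1 : ∀ i, 1 ≤ i → (p : 𝒪) ∣ φO.coeff i)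
    {A B : 𝒪} (hA : ι₀ (j A) = W.a₄) (hB : ι₀ (j B) = W.a₆)
    {s : Fin 3 → S} (hfac : veluF (W⁄F) = (X - C (f (s 0))) * (X - C (f (s 1))) * (X - C (f (s 2))))
    (u : Fin 3 → Sˣ) (hu : ∀ i, (u i : S) = (φO.map ι).eval (s i))
    (hcard : 2 * (veluXVals G).card + 1 = p) :
    ∃ U₀ : 𝒪[X], U₀.map (ι₀.comp j) = veluU G ∧ ∀ i, (p : 𝒪) ∣ (U₀ - X ^ p).coeff i := by
  set n := (veluXVals G).card with hndef
  have hp0 : (p : F) ≠ 0 := Nat.cast_ne_zero.mpr hp.out.ne_zero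
  have hn : 1 ≤ n := by have := hp.out.two_le; omega
  have hfι : ∀ x, f (ι x) = ι₀ (j x) := fun x => RingHom.congr_fun hcomm x
  -- `U` over `K₀`
  set DK : K₀[X] := C ((p : K₀)⁻¹) * φO.map j with hDKdef
  have hDK : DK.map ι₀ = veluD G := by
    rw [hDKdef, Polynomial.map_mul, map_C, Polynomial.map_map, hφF, map_inv₀, map_natCast, ← mul_assoc,
      ← C_mul, inv_mul_cancel₀ hp0, C_1, one_mul]
  obtain ⟨UK, hUK⟩ := exists_map_eq_veluU W ι₀ hG hn hDK hA hB
  -- `3U` over `S`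
  have hφS : (φO.map ι).map f = C (p : F) * veluD G := by rw [Polynomial.map_map, hcomm, hφF]
  have hAS : f (ι A) = (W⁄F).a₄ := (hfι A).trans hA
  have hBS : f (ι B) = (W⁄F).a₆ := (hfι B).trans hB
  have h3U := three_mul_veluU_eq_map f hG hp0 hφS hAS hBS hfac u hu
  rw [← hndef] at h3U
  set T := veluThreeU (φO.map ι) (ι A) (ι B) s u n with hT
  -- glue: `3·UK ∈ lifts j`
  have hlift : (3 * UK) ∈ lifts j := by
    rw [lifts_iff_coeff_lifts]
    intro i
    apply hOK
    refine ⟨T.coeff i, ?_⟩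
    have h := congrArg (fun q => Polynomial.coeff q i) h3U
    simp only [coeff_map] at h
    rw [← h, ← hUK, show (3 : F[X]) * UK.map ι₀ = (3 * UK).map ι₀ by rw [Polynomial.map_mul, Polynomial.map_ofNat],
      coeff_map]
  obtain ⟨U₃, hU₃⟩ := (mem_lifts _).mp hlift
  obtain ⟨w, hw⟩ := h3
  have hw3 : C (↑w⁻¹ : 𝒪) * (3 : 𝒪[X]) = 1 := by
    rw [show (3 : 𝒪[X]) = C (3 : 𝒪) from (map_ofNat C 3).symm, ← C_mul, ← hw, Units.inv_mul, C_1]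
  refine ⟨C (↑w⁻¹ : 𝒪) * U₃, ?_, ?_⟩
  · have h13 : C (ι₀ (j (↑w⁻¹ : 𝒪))) * (3 : F[X]) = 1 := by
      have := congrArg (Polynomial.map (ι₀.comp j)) hw3
      rw [Polynomial.map_mul, Polynomial.map_C, Polynomial.map_ofNat, Polynomial.map_one] at this
      simpa only [RingHom.coe_comp, Function.comp_apply] using this
    rw [← Polynomial.map_map, Polynomial.map_mul, Polynomial.map_C, hU₃, Polynomial.map_mul, Polynomial.map_mul,
      Polynomial.map_C, Polynomial.map_ofNat, hUK, ← mul_assoc, h13, one_mul]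
  · -- the congruence
    have hs : s 0 + s 1 + s 2 = 0 := by
      apply hfi
      rw [map_add, map_add, _root_.map_zero]
      exact sum_roots_eq_zero W (r := fun i => f (s i)) hfac
    have hTπ := veluThreeU_map_eq π (p := p) (φS := φO.map ι) (map_coeff_map_eq_zero ι π hφ1) (ι A) (ι B)
      hs u hu hcard
    have hU₃T : U₃.map ι = T := by
      have h : (U₃.map ι).map f = T.map f := by
        rw [Polynomial.map_map, hcomm, ← Polynomial.map_map, hU₃, Polynomial.map_mul, Polynomial.map_ofNat, hUK, h3U]
      exact Polynomial.map_injective (f := f) hfi h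
    have hzero : (U₃ - 3 * X ^ p).map (π.comp ι) = 0 := by
      rw [Polynomial.map_sub, ← Polynomial.map_map, hU₃T, hT, hTπ, Polynomial.map_mul, Polynomial.map_ofNat,
        Polynomial.map_pow, map_X, sub_self]
    intro i
    have hi := congrArg (fun q => Polynomial.coeff q i) hzero
    simp only [coeff_map, coeff_zero, RingHom.coe_comp, Function.comp_apply] at hi
    have hdiv := hker _ hi
    have hrw : C (↑w⁻¹ : 𝒪) * U₃ - X ^ p = C (↑w⁻¹ : 𝒪) * (U₃ - 3 * X ^ p) := by
      rw [mul_sub, ← mul_assoc, hw3, one_mul]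
    rw [hrw, coeff_C_mul]
    exact Dvd.dvd.mul_left hdiv _

/-! ### `M_D ∈ 𝒪[X]` and `M_D ≡ f^{(p-1)/2} (mod p)` (Blakestad–Grant Prop. 7(a): `M ≡ f^{(p-1)/2}`) -/

omit hp in
/-- `Q.map (mk (p)) = 0 ↔ p ∣ Qᵢ` for all `i`. [folklore] -/
theorem map_mk_eq_zero_iff {R : Type*} [CommRing R] (a : R) (Q : R[X]) :
    Q.map (Ideal.Quotient.mk (Ideal.span {a})) = 0 ↔ ∀ i, a ∣ Q.coeff i := by
  simp only [Polynomial.ext_iff, coeff_map, coeff_zero, Ideal.Quotient.eq_zero_iff_mem, Ideal.mem_span_singleton]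

omit hp in
/-- `p ∣ Qᵢ` for all `i` iff `Q ∈ (p)·R[X]`. [folklore] -/
theorem forall_dvd_coeff_iff_mem {R : Type*} [CommRing R] (a : R) (Q : R[X]) :
    (∀ i, a ∣ Q.coeff i) ↔ Q ∈ (Ideal.span {a} : Ideal R).map (C : R →+* R[X]) := by
  rw [Ideal.mem_map_C_iff]
  simp only [Ideal.mem_span_singleton]

omit hp in
/-- The monic short cubic `f₀ = X³ + AX + B` over `𝒪`. [folklore] -/
theorem monic_shortCubic (A B : 𝒪) : (X ^ 3 + C A * X + C B : 𝒪[X]).Monic := by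
  rw [add_assoc]
  exact monic_X_pow_add ((degree_linear_le).trans_lt (by decide))

omit [CharZero F] [W.IsShortNF] [W.IsElliptic] hp in
/-- `f₀^{ι₀j} = f` (the Vélu cubic of `W` is `X³ + a₄X + a₆`). [folklore] -/
theorem map_shortCubic_eq_veluF {A B : 𝒪} (hA : ι₀ (j A) = W.a₄) (hB : ι₀ (j B) = W.a₆) :
    (X ^ 3 + C A * X + C B : 𝒪[X]).map (ι₀.comp j) = veluF (W⁄F) := by
  rw [veluF, Polynomial.map_add, Polynomial.map_add, Polynomial.map_mul, Polynomial.map_pow, map_X, map_C, map_C,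
    RingHom.comp_apply, RingHom.comp_apply, hA, hB]
  rfl

/-- **`M_D ∈ 𝒪[X]`, monic, and `M_D ≡ f^{(p-1)/2} (mod p)`** (Blakestad–Grant Prop. 7(a):
"`y_p = yM(x)/φ_ψ(x)³` for some `M(x) ∈ R̂[x]` of degree `(3p-3)/2` such that
`M(x) ≡ f(x)^{(p-1)/2} mod p`"). Proof: `p·M_D = U'φ - 2Uφ'` is the image of
`U₀'φ - 2U₀φ' ∈ p𝒪[X]` (`U₀ ≡ X^p`, `φ ≡ ℓ₀`), giving `M₀`; then `f·M_D² = P^f` with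
`P ≡ f^p (mod p)` (`veluThreeP_map_eq`) descends along the INJECTION `𝒪/p ↪ S/ker π` to
`f̄·M̄₀² = f̄^p = f̄·(f̄^n)²` in the domain `(𝒪/p)[X]`, so `M̄₀ = ±f̄^n`, and `-` is excluded by the
leading coefficients (`p ∤ 2`). [Blakestad–Grant 2023, Prop. 7(a)] [cite: BlakestadGrant2023, Prop. 7] -/
theorem exists_veluMD_lift [CharP k p] (hG : IsOddSubgroupFinset G) (hcomm : f.comp ι = ι₀.comp j)
    (hfi : Function.Injective f) (hji : Function.Injective j)
    (hker : ∀ c : 𝒪, π (ι c) = 0 → (p : 𝒪) ∣ c) (hprime : (Ideal.span {(p : 𝒪)}).IsPrime)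
    (h2 : ¬ (p : 𝒪) ∣ 2)
    {φO : 𝒪[X]} (hφF : φO.map (ι₀.comp j) = C (p : F) * veluD G) (hφ1 : ∀ i, 1 ≤ i → (p : 𝒪) ∣ φO.coeff i)
    {A B : 𝒪} (hA : ι₀ (j A) = W.a₄) (hB : ι₀ (j B) = W.a₆)
    {s : Fin 3 → S} (hfac : veluF (W⁄F) = (X - C (f (s 0))) * (X - C (f (s 1))) * (X - C (f (s 2))))
    (u : Fin 3 → Sˣ) (hu : ∀ i, (u i : S) = (φO.map ι).eval (s i))
    (hcard : 2 * (veluXVals G).card + 1 = p)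
    {U₀ : 𝒪[X]} (hU₀ : U₀.map (ι₀.comp j) = veluU G) (hU₀p : ∀ i, (p : 𝒪) ∣ (U₀ - X ^ p).coeff i) :
    ∃ M₀ : 𝒪[X], M₀.map (ι₀.comp j) = veluMD G ∧ M₀.Monic ∧
      ∀ i, (p : 𝒪) ∣ (M₀ - (X ^ 3 + C A * X + C B) ^ (veluXVals G).card).coeff i := by
  set n := (veluXVals G).card with hndef
  set alg := ι₀.comp j with halg
  have halgi : Function.Injective alg := ι₀.injective.comp hji
  have hp0 : (p : F) ≠ 0 := Nat.cast_ne_zero.mpr hp.out.ne_zero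
  set I : Ideal 𝒪 := Ideal.span {(p : 𝒪)} with hI
  -- (a) `p·M_D` is the image of `M₁ = U₀'φ - 2U₀φ'`
  set M₁ := derivative U₀ * φO - 2 * U₀ * derivative φO with hM₁
  have hD : veluD G = C ((p : F)⁻¹) * φO.map alg := by
    rw [hφF, ← mul_assoc, ← C_mul, inv_mul_cancel₀ hp0, C_1, one_mul]
  have hM₁F : M₁.map alg = C (p : F) * veluMD G := by
    rw [veluMD, ← hU₀, hD, Polynomial.derivative_map, derivative_C_mul, Polynomial.derivative_map, hM₁,
      Polynomial.map_sub, Polynomial.map_mul, Polynomial.map_mul, Polynomial.map_mul, Polynomial.map_ofNat]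
    have hpinv : C (p : F) * C ((p : F)⁻¹) = 1 := by rw [← C_mul, mul_inv_cancel₀ hp0, C_1]
    linear_combination (-(derivative U₀).map alg * φO.map alg + 2 * U₀.map alg * (derivative φO).map alg) * hpinv
  -- (b) `M₁ ∈ p𝒪[X]`
  have hdU : ∀ i, (p : 𝒪) ∣ (derivative U₀).coeff i := by
    intro i
    rw [coeff_derivative, show U₀.coeff (i + 1) = (U₀ - X ^ p).coeff (i + 1) + (X ^ p : 𝒪[X]).coeff (i + 1) by
      rw [coeff_sub, sub_add_cancel], coeff_X_pow]
    split_ifs with hip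
    · have hc : ((i : 𝒪) + 1) = (p : 𝒪) := by rw [← hip, Nat.cast_succ]
      rw [hc]; exact dvd_mul_left _ _
    · rw [add_zero]; exact Dvd.dvd.mul_right (hU₀p _) _
  have hdφ : ∀ i, (p : 𝒪) ∣ (derivative φO).coeff i := by
    intro i
    rw [coeff_derivative]
    exact Dvd.dvd.mul_right (hφ1 _ (Nat.succ_pos i)) _
  have hM₁mem : M₁ ∈ I.map (C : 𝒪 →+* 𝒪[X]) := by
    have h1 := (forall_dvd_coeff_iff_mem (p : 𝒪) _).mp hdU
    have h2 := (forall_dvd_coeff_iff_mem (p : 𝒪) _).mp hdφ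
    exact Ideal.sub_mem _ (Ideal.mul_mem_right _ _ h1) (Ideal.mul_mem_left _ _ h2)
  -- (c) `M₁ = M₀·p`
  rw [hI, Ideal.map_span, Set.image_singleton, Ideal.mem_span_singleton'] at hM₁mem
  obtain ⟨M₀, hM₀⟩ := hM₁mem
  have hM₀F : M₀.map alg = veluMD G := by
    have h := hM₁F
    rw [← hM₀, Polynomial.map_mul, map_C, map_natCast, mul_comm] at h
    exact mul_left_cancel₀ (C_ne_zero.mpr hp0) h
  have hM₀monic : M₀.Monic := monic_of_injective halgi (by rw [hM₀F]; exact monic_veluMD hG)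
  refine ⟨M₀, hM₀F, hM₀monic, ?_⟩
  -- (d) the congruence
  set f₀ : 𝒪[X] := X ^ 3 + C A * X + C B with hf₀
  have hf₀monic : f₀.Monic := monic_shortCubic A B
  have hf₀F : f₀.map alg = veluF (W⁄F) := map_shortCubic_eq_veluF W ι₀ j hA hB
  have hfι : ∀ x, f (ι x) = ι₀ (j x) := fun x => RingHom.congr_fun hcomm x
  have hφS : (φO.map ι).map f = C (p : F) * veluD G := by rw [Polynomial.map_map, hcomm, hφF]
  have hAS : f (ι A) = W.a₄ := (hfι A).trans hA
  have hBS : f (ι B) = W.a₆ := (hfι B).trans hB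
  have hP := veluF_mul_veluMD_sq_eq_map f hG hp0 hφS hAS hBS hfac u hu
  rw [← hndef] at hP
  set P := veluThreeP (φO.map ι) (ι A) (ι B) s u n with hPdef
  -- `(f₀M₀²)^ι = P` and `(Π(X - sᵢ)) = f₀^ι`
  have h1 : (f₀ * M₀ ^ 2).map ι = P := by
    refine Polynomial.map_injective (f := f) hfi ?_
    rw [Polynomial.map_map, hcomm, Polynomial.map_mul, Polynomial.map_pow, hf₀F, hM₀F, hP]
  have hfs : (X - C (s 0)) * (X - C (s 1)) * (X - C (s 2)) = f₀.map ι := by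
    refine Polynomial.map_injective (f := f) hfi ?_
    rw [Polynomial.map_map, hcomm, hf₀F, hfac]
    simp only [Polynomial.map_mul, Polynomial.map_sub, map_X, map_C]
  have hPπ := veluThreeP_map_eq π (p := p) (map_coeff_map_eq_zero ι π hφ1) (ι A) (ι B) s u hu hcard
  -- descend along `ῑ : 𝒪/p ↪ k`
  have hkill : ∀ a ∈ I, (π.comp ι) a = 0 := by
    intro a ha
    obtain ⟨c, rfl⟩ := Ideal.mem_span_singleton'.mp ha
    rw [RingHom.comp_apply, map_mul, map_mul, map_natCast, map_natCast, CharP.cast_eq_zero, mul_zero]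
  set ῑ : 𝒪 ⧸ I →+* k := Ideal.Quotient.lift I (π.comp ι) hkill with hῑ
  have hῑinj : Function.Injective ῑ := by
    rw [injective_iff_map_eq_zero]
    intro x hx
    obtain ⟨c, rfl⟩ := Ideal.Quotient.mk_surjective x
    rw [hῑ, Ideal.Quotient.lift_mk, RingHom.comp_apply] at hx
    exact Ideal.Quotient.eq_zero_iff_mem.mpr (Ideal.mem_span_singleton.mpr (hker c hx))
  have hcompq : π.comp ι = ῑ.comp (Ideal.Quotient.mk I) := by
    ext c; rw [hῑ, RingHom.comp_apply, RingHom.comp_apply, Ideal.Quotient.lift_mk, RingHom.comp_apply]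
  set mk := Ideal.Quotient.mk I with hmk
  have hq : (f₀ * M₀ ^ 2 - f₀ ^ p).map mk = 0 := by
    refine Polynomial.map_injective (f := ῑ) hῑinj ?_
    rw [Polynomial.map_zero, Polynomial.map_map, ← hcompq, ← Polynomial.map_map, Polynomial.map_sub,
      Polynomial.map_sub, h1, hPdef, hPπ, hfs, Polynomial.map_pow, Polynomial.map_pow, sub_self]
  -- in the domain `(𝒪/p)[X]`
  haveI : I.IsPrime := hprime
  have hf₁monic : (f₀.map mk).Monic := hf₀monic.map mk
  have hN₁monic : (M₀.map mk).Monic := hM₀monic.map mk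
  have hsq : (M₀.map mk) ^ 2 = ((f₀.map mk) ^ n) ^ 2 := by
    have h := hq
    rw [Polynomial.map_sub, Polynomial.map_mul, Polynomial.map_pow, Polynomial.map_pow, sub_eq_zero, ← hcard,
      pow_succ' (f₀.map mk) (2 * n), pow_mul'] at h
    exact mul_left_cancel₀ hf₁monic.ne_zero h
  rcases sq_eq_sq_iff_eq_or_eq_neg.mp hsq with h | h
  · intro i
    have := (map_mk_eq_zero_iff (p : 𝒪) (M₀ - f₀ ^ n)).mp (by
      rw [Polynomial.map_sub, Polynomial.map_pow, sub_eq_zero]; exact h) i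
    exact this
  · exfalso
    have hlc := congrArg Polynomial.leadingCoeff h
    rw [hN₁monic.leadingCoeff, leadingCoeff_neg, (hf₁monic.pow n).leadingCoeff] at hlc
    apply h2
    refine Ideal.mem_span_singleton.mp (Ideal.Quotient.eq_zero_iff_mem.mp ?_)
    rw [map_ofNat]
    linear_combination hlc

/-! ### `A'_p, B'_p ∈ 𝒪` and `A'_pℓ₀⁴ ≡ A^p`, `B'_pℓ₀⁶ ≡ B^p` (Blakestad–Grant Prop. 7(a), eq. (6)) -/

omit hp in
/-- `[X⁰](Q^m) = ([X⁰]Q)^m`. [folklore] -/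
theorem coeff_zero_pow' {R : Type*} [CommRing R] (Q : R[X]) (m : ℕ) : (Q ^ m).coeff 0 = Q.coeff 0 ^ m := by
  rw [coeff_zero_eq_eval_zero, eval_pow, ← coeff_zero_eq_eval_zero]

/-- **The quotient model `E'_p` is `p`-integral and congruent to the Frobenius twist.** With
`U₀ ≡ X^p`, `M₀ ≡ f^n` the lifts of `U`, `M_D` (`exists_veluU_lift`, `exists_veluMD_lift`):
there are `A₀, B₀ ∈ 𝒪` with `a' = p⁴A₀`, `b' = p⁶B₀` (`a', b'` Vélu's coefficients), the model
`E'_p : y_p² = x_p³ + A₀x_p + B₀` (`x_p = U/φ², y_p = yM/φ³`, `ψ^*ω_p = pω`) in polynomial form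
**`f·M₀² = U₀³ + A₀U₀φ⁴ + B₀φ⁶` in `𝒪[X]`**, and **`A₀ℓ₀⁴ ≡ A^p`, `B₀ℓ₀⁶ ≡ B^p (mod p)`**
(Blakestad–Grant Prop. 7(a): "`A'_{4,p}` and `A'_{6,p}` … reduce respectively to `A₄^p/H⁴` and
`A₆^p/H⁶` mod `p`", `ℓ̃₀ ≡ H`; integrality by "Gauss's lemma gives (6)", here
`mem_lifts_of_mul_eq_map`; the congruences by reducing `f·M² = U³ + A'Uφ⁴ + B'φ⁶` modulo `p`,
where it reads `f·f^{p-1} = x^{3p} + A'ℓ₀⁴x^p + B'ℓ₀⁶` against `f^p = x^{3p} + A^px^p + B^p`).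
[Blakestad–Grant 2023, Prop. 7(a)] [cite: BlakestadGrant2023, Prop. 7] -/
theorem exists_veluAB_lift (hG : IsOddSubgroupFinset G) (hji : Function.Injective j)
    (hprime : (Ideal.span {(p : 𝒪)}).IsPrime)
    {φO : 𝒪[X]} (hφF : φO.map (ι₀.comp j) = C (p : F) * veluD G) (hφ1 : ∀ i, 1 ≤ i → (p : 𝒪) ∣ φO.coeff i)
    (hℓ : IsUnit (φO.coeff 0)) {A B : 𝒪} (hA : ι₀ (j A) = W.a₄) (hB : ι₀ (j B) = W.a₆)
    (hcard : 2 * (veluXVals G).card + 1 = p)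
    {U₀ : 𝒪[X]} (hU₀ : U₀.map (ι₀.comp j) = veluU G) (hU₀p : ∀ i, (p : 𝒪) ∣ (U₀ - X ^ p).coeff i)
    {M₀ : 𝒪[X]} (hM₀ : M₀.map (ι₀.comp j) = veluMD G)
    (hM₀p : ∀ i, (p : 𝒪) ∣ (M₀ - (X ^ 3 + C A * X + C B) ^ (veluXVals G).card).coeff i) :
    ∃ A₀ B₀ : 𝒪, ι₀ (j A₀) * (p : F) ^ 4 = veluA G ∧ ι₀ (j B₀) * (p : F) ^ 6 = veluB G ∧
      (X ^ 3 + C A * X + C B) * M₀ ^ 2 = U₀ ^ 3 + C A₀ * U₀ * φO ^ 4 + C B₀ * φO ^ 6 ∧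
      (p : 𝒪) ∣ A₀ * φO.coeff 0 ^ 4 - A ^ p ∧ (p : 𝒪) ∣ B₀ * φO.coeff 0 ^ 6 - B ^ p := by
  set n := (veluXVals G).card with hndef
  set alg := ι₀.comp j with halg
  have halgi : Function.Injective alg := ι₀.injective.comp hji
  have hp0 : (p : F) ≠ 0 := Nat.cast_ne_zero.mpr hp.out.ne_zero
  have hpK : (p : K₀) ≠ 0 := fun h => hp0 (by rw [← map_natCast ι₀, h, _root_.map_zero])
  have hn : 1 ≤ n := by have := hp.out.two_le; omega
  set f₀ : 𝒪[X] := X ^ 3 + C A * X + C B with hf₀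
  have hf₀F : f₀.map alg = veluF (W⁄F) := map_shortCubic_eq_veluF W ι₀ j hA hB
  -- degrees
  have hUdeg : (veluU G).natDegree = p := by rw [natDegree_veluU hG, card_erase_zero_eq hG, ← hndef, hcard]
  have hUmonic := monic_veluU hG
  have hDdeg : (veluD G).natDegree = n := natDegree_veluD G
  have hDmonic := monic_veluD G
  have hφdeg : φO.natDegree = n := by
    rw [← natDegree_map_eq_of_injective halgi, hφF, natDegree_C_mul hp0, hDdeg]
  have hUD4monic : (veluU G * veluD G ^ 4).Monic := hUmonic.mul (hDmonic.pow 4)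
  have hUD4deg : (veluU G * veluD G ^ 4).natDegree = 6 * n + 1 := by
    rw [hUmonic.natDegree_mul (hDmonic.pow 4), natDegree_pow, hUdeg, hDdeg, ← hcard]; ring
  have hD6deg : (veluD G ^ 6).natDegree = 6 * n := by rw [natDegree_pow, hDdeg]
  -- the identity over `F`
  have hV := veluF_mul_veluMD_sq hG
  set a' := veluA G with ha'
  set b' := veluB G with hb'
  set E₀ := f₀ * M₀ ^ 2 - U₀ ^ 3 with hE₀
  have hE : E₀.map alg = C a' * veluU G * veluD G ^ 4 + C b' * veluD G ^ 6 := by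
    rw [hE₀, Polynomial.map_sub, Polynomial.map_mul, Polynomial.map_pow, Polynomial.map_pow, hf₀F, hM₀, hU₀, hV]
    ring
  -- (i) `a' ∈ alg(𝒪)`
  set a₁ := E₀.coeff (6 * n + 1) with ha₁
  have ha₁F : alg a₁ = a' := by
    rw [ha₁, ← coeff_map, hE, coeff_add, mul_assoc, coeff_C_mul, coeff_C_mul, ← hUD4deg, hUD4monic.coeff_natDegree,
      hUD4deg, coeff_eq_zero_of_natDegree_lt (by rw [hD6deg]; omega), mul_one, mul_zero, add_zero]
  -- (ii) `b' ∈ ι₀(K₀)`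
  set UK := U₀.map j with hUK
  set DK : K₀[X] := C ((p : K₀)⁻¹) * φO.map j with hDKdef
  have hDK : DK.map ι₀ = veluD G := by
    rw [hDKdef, Polynomial.map_mul, map_C, Polynomial.map_map, ← halg, hφF, map_inv₀, map_natCast, ← mul_assoc,
      ← C_mul, inv_mul_cancel₀ hp0, C_1, one_mul]
  have hUKF : UK.map ι₀ = veluU G := by rw [hUK, Polynomial.map_map, ← halg, hU₀]
  set bK : K₀ := j (E₀.coeff (6 * n)) - j a₁ * (UK * DK ^ 4).coeff (6 * n) with hbK
  have hbKF : ι₀ bK = b' := by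
    have h6 := congrArg (Polynomial.coeff · (6 * n)) hE
    simp only [coeff_map, coeff_add, mul_assoc, coeff_C_mul] at h6
    rw [← hD6deg, (hDmonic.pow 6).coeff_natDegree, hD6deg, mul_one] at h6
    have hc : ι₀ ((UK * DK ^ 4).coeff (6 * n)) = (veluU G * veluD G ^ 4).coeff (6 * n) := by
      rw [← coeff_map, Polynomial.map_mul, Polynomial.map_pow, hUKF, hDK]
    rw [hbK, map_sub, map_mul, hc, ← RingHom.comp_apply, ← RingHom.comp_apply, ← halg, ha₁F]
    linear_combination h6
  -- (iii) `T_K·(φ⁴)^j = E₀^j` over `K₀`, `T_K = (a'/p⁴)U + (b'/p⁶)φ²`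
  set φK := φO.map j with hφK
  have hφKF : φK.map ι₀ = C (p : F) * veluD G := by rw [hφK, Polynomial.map_map, ← halg, hφF]
  set TK : K₀[X] := C (j a₁ / (p : K₀) ^ 4) * UK + C (bK / (p : K₀) ^ 6) * φK ^ 2 with hTK
  have e1 : ι₀ (j a₁ / (p : K₀) ^ 4) = a' / (p : F) ^ 4 := by
    rw [map_div₀, map_pow, map_natCast, ← RingHom.comp_apply, ← halg, ha₁F]
  have e2 : ι₀ (bK / (p : K₀) ^ 6) = b' / (p : F) ^ 6 := by
    rw [map_div₀, map_pow, map_natCast, hbKF]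
  have hTKF : TK.map ι₀ = C (a' / (p : F) ^ 4) * veluU G + C (b' / (p : F) ^ 6) * (C (p : F) * veluD G) ^ 2 := by
    rw [hTK, Polynomial.map_add, Polynomial.map_mul, Polynomial.map_mul, map_C, map_C, Polynomial.map_pow, hUKF,
      hφKF, e1, e2]
  have hTE : TK * (φO ^ 4).map j = E₀.map j := by
    refine Polynomial.map_injective (f := ι₀) ι₀.injective ?_
    rw [Polynomial.map_mul, hTKF, Polynomial.map_map, ← halg, Polynomial.map_pow, hφF, Polynomial.map_map, ← halg, hE]
    have h4 : C (a' / (p : F) ^ 4) * C (p : F) ^ 4 = C a' := by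
      rw [← C_pow, ← C_mul, div_mul_cancel₀ _ (pow_ne_zero 4 hp0)]
    have h6 : C (b' / (p : F) ^ 6) * C (p : F) ^ 6 = C b' := by
      rw [← C_pow, ← C_mul, div_mul_cancel₀ _ (pow_ne_zero 6 hp0)]
    linear_combination (veluU G * veluD G ^ 4) * h4 + veluD G ^ 6 * h6
  -- (iv) `T_K ∈ 𝒪[X]`
  have hℓ4 : (φO ^ 4).coeff 0 = ↑(hℓ.unit ^ 4) := by
    rw [coeff_zero_pow', Units.val_pow_eq_pow_val, IsUnit.unit_spec]
  obtain ⟨T₀, hT₀⟩ := (mem_lifts _).mp (mem_lifts_of_mul_eq_map j hTE (hℓ.unit ^ 4) hℓ4)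
  -- (v) `A₀`
  have hU₀p' : U₀.coeff p = 1 := by
    apply halgi
    rw [← coeff_map, hU₀, ← hUdeg, hUmonic.coeff_natDegree, map_one]
  have hφK2 : (φK ^ 2).coeff p = 0 := by
    refine coeff_eq_zero_of_natDegree_lt (natDegree_pow_le.trans_lt ?_)
    rw [hφK, natDegree_map_eq_of_injective hji, hφdeg]; omega
  set A₀ := T₀.coeff p with hA₀
  have hA₀K : j A₀ = j a₁ / (p : K₀) ^ 4 := by
    rw [hA₀, ← coeff_map, hT₀, hTK, coeff_add, coeff_C_mul, coeff_C_mul, hUK, coeff_map, hU₀p', map_one, mul_one,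
      hφK2, mul_zero, add_zero]
  have hA₀F : ι₀ (j A₀) * (p : F) ^ 4 = a' := by
    rw [hA₀K, map_div₀, map_pow, map_natCast, div_mul_cancel₀ _ (pow_ne_zero 4 hp0), ← RingHom.comp_apply, ← halg, ha₁F]
  -- (vi) `B₀`
  have hjℓ : j (φO.coeff 0) * j (↑(hℓ.unit⁻¹) : 𝒪) = 1 := by
    rw [← map_mul, IsUnit.mul_val_inv, map_one]
  set B₀ := (T₀.coeff 0 - A₀ * U₀.coeff 0) * (↑(hℓ.unit⁻¹) : 𝒪) ^ 2 with hB₀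
  have hT0 : j (T₀.coeff 0) = j A₀ * j (U₀.coeff 0) + bK / (p : K₀) ^ 6 * j (φO.coeff 0) ^ 2 := by
    rw [← coeff_map, hT₀, hTK, coeff_add, coeff_C_mul, coeff_C_mul, hUK, coeff_map, coeff_zero_pow', hφK, coeff_map,
      hA₀K]
  have hB₀K : j B₀ = bK / (p : K₀) ^ 6 := by
    rw [hB₀, map_mul, map_sub, map_mul, map_pow]
    linear_combination (j ↑(hℓ.unit⁻¹) ^ 2) * hT0 +
      (bK / (p : K₀) ^ 6) * (j (φO.coeff 0) * j ↑(hℓ.unit⁻¹) + 1) * hjℓ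
  have hB₀F : ι₀ (j B₀) * (p : F) ^ 6 = b' := by
    rw [hB₀K, map_div₀, map_pow, map_natCast, div_mul_cancel₀ _ (pow_ne_zero 6 hp0), hbKF]
  -- (vii) the identity in `𝒪[X]`
  have hid : f₀ * M₀ ^ 2 = U₀ ^ 3 + C A₀ * U₀ * φO ^ 4 + C B₀ * φO ^ 6 := by
    refine Polynomial.map_injective (f := alg) halgi ?_
    rw [Polynomial.map_mul, Polynomial.map_pow, hf₀F, hM₀, hV, Polynomial.map_add, Polynomial.map_add,
      Polynomial.map_mul, Polynomial.map_mul, Polynomial.map_mul, Polynomial.map_pow, Polynomial.map_pow,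
      Polynomial.map_pow, map_C, map_C, hU₀, hφF]
    have h4 : C (alg A₀) * C (p : F) ^ 4 = C a' := by
      rw [← C_pow, ← C_mul, halg, RingHom.comp_apply, hA₀F]
    have h6 : C (alg B₀) * C (p : F) ^ 6 = C b' := by
      rw [← C_pow, ← C_mul, halg, RingHom.comp_apply, hB₀F]
    linear_combination -(veluU G * veluD G ^ 4) * h4 - veluD G ^ 6 * h6
  refine ⟨A₀, B₀, hA₀F, hB₀F, hid, ?_⟩
  -- (viii) reduction modulo `p`
  set I : Ideal 𝒪 := Ideal.span {(p : 𝒪)} with hI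
  haveI : I.IsPrime := hprime
  have hpnu : ¬IsUnit (p : 𝒪) := fun hu => hprime.ne_top (Ideal.span_singleton_eq_top.mpr hu)
  haveI : CharP (𝒪 ⧸ I) p := CharP.quotient 𝒪 p (mem_nonunits_iff.mpr hpnu)
  set mk := Ideal.Quotient.mk I with hmk
  have hUbar : U₀.map mk = X ^ p := by
    have := (map_mk_eq_zero_iff (p : 𝒪) (U₀ - X ^ p)).mpr hU₀p
    rwa [Polynomial.map_sub, Polynomial.map_pow, map_X, sub_eq_zero] at this
  have hMbar : M₀.map mk = (f₀.map mk) ^ n := by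
    have := (map_mk_eq_zero_iff (p : 𝒪) (M₀ - f₀ ^ n)).mpr hM₀p
    rwa [Polynomial.map_sub, Polynomial.map_pow, sub_eq_zero] at this
  have hφbar : φO.map mk = C (mk (φO.coeff 0)) := by
    ext i
    rw [coeff_map, coeff_C]
    split_ifs with hi
    · rw [hi]
    · exact Ideal.Quotient.eq_zero_iff_mem.mpr (Ideal.mem_span_singleton.mpr (hφ1 i (Nat.one_le_iff_ne_zero.mpr hi)))
  have hfbar : f₀.map mk = X ^ 3 + C (mk A) * X + C (mk B) := by
    rw [hf₀, Polynomial.map_add, Polynomial.map_add, Polynomial.map_mul, Polynomial.map_pow, map_X, map_C, map_C]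
  -- `f̄^p = X^{3p} + Ā^p X^p + B̄^p` (Frobenius) versus the reduced identity
  have hfrob : (f₀.map mk) ^ p = (X ^ p) ^ 3 + C (mk A ^ p) * X ^ p + C (mk B ^ p) := by
    rw [hfbar, add_pow_char, add_pow_char, mul_pow, ← pow_mul, ← pow_mul, mul_comm 3 p, C_pow, C_pow]
  have hred := congrArg (Polynomial.map mk) hid
  rw [Polynomial.map_mul, Polynomial.map_pow, hMbar, ← pow_mul, ← pow_succ', show n * 2 + 1 = p by omega, hfrob,
    Polynomial.map_add, Polynomial.map_add, Polynomial.map_mul, Polynomial.map_mul, Polynomial.map_mul,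
    Polynomial.map_pow, Polynomial.map_pow, Polynomial.map_pow, map_C, map_C, hUbar, hφbar, ← C_pow, ← C_pow] at hred
  set ℓ := mk (φO.coeff 0) with hℓdef
  have key : C (mk A ^ p - mk A₀ * ℓ ^ 4) * X ^ p + C (mk B ^ p - mk B₀ * ℓ ^ 6) = 0 := by
    rw [map_sub, map_sub, map_mul, map_mul]
    linear_combination hred
  have hp1 : p ≠ 0 := hp.out.ne_zero
  have kp := congrArg (Polynomial.coeff · p) key
  have k0 := congrArg (Polynomial.coeff · 0) key
  simp only [coeff_add, coeff_C_mul, coeff_X_pow, coeff_C, if_true, hp1, if_false, coeff_zero, mul_one, mul_zero,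
    add_zero, zero_add, if_neg (Ne.symm hp1)] at kp k0
  have hdvd : ∀ x : 𝒪, mk x = 0 → (p : 𝒪) ∣ x := fun x hx =>
    Ideal.mem_span_singleton.mp (Ideal.Quotient.eq_zero_iff_mem.mp hx)
  refine ⟨hdvd _ ?_, hdvd _ ?_⟩
  · rw [map_sub, map_mul, map_pow, map_pow]; linear_combination -kp
  · rw [map_sub, map_mul, map_pow, map_pow]; linear_combination -k0

end Integral

/-! ### The formal isogeny: `t_p = t·Φ·u`, `u ≡ 1`, `t_p ≡ ℓ₀t^p (mod p)` (Blakestad–Grant Prop. 7(c), Lemma 12) -/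

section FormalIsog

open PowerSeries

variable {𝒪 : Type*} [CommRing 𝒪] (W : WeierstrassCurve 𝒪)

/-- **The unit `u = 𝒰/(X·ℳ) ∈ 𝒪⟦t⟧`** of Blakestad–Grant's Lemma 12 (`t' = H⁻¹t^pφ_ψ(x)u`):
`𝒰 = t^{2p}U(x(t))`, `ℳ = t^{6n}M(x(t))`, `X = t²x(t)` are the cleared expansions of Vélu's
numerator `U`, of the `y`-numerator `M` and of `x`. [Blakestad–Grant 2023, Prop. 7(c) (`t_{p/H}` is
"a power series in `R̂⟦t⟧` divided by an invertible power series in `R̂⟦t⟧`"), Lemma 12 (`u(t)`)]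
[cite: BlakestadGrant2023, Lemma 12] -/
def veluFormalUnit (U₀ M₀ : 𝒪[X]) (p n : ℕ) : PowerSeries 𝒪 :=
  W.clearedEval p U₀ * (W.formalXMulSq * W.clearedEval (3 * n) M₀).invOfUnit 1

/-- **The formal isogeny `t_p = -x_p/y_p = t·Φ·u`** (`Φ = t^{2n}φ(x(t))`, so `t·Φ = t^pφ(x(t))`
when `p = 2n + 1`): the `t`-coordinate on `E'_p : x_p = U/φ², y_p = yM/φ³` of the image of the
formal point, `-Uφ/(yM)` with `y = -X/t³`. [Blakestad–Grant 2023, Prop. 7(c)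
(`t_{p/H} = -S(x(t))φ_ψ(x(t))/(HM(x(t))y(t))`), Lemma 12 (`t' = H⁻¹(t^pφ_ψ(x))u(t)`)]
[cite: BlakestadGrant2023, Prop. 7] -/
def veluFormalIsog (φO U₀ M₀ : 𝒪[X]) (p n : ℕ) : PowerSeries 𝒪 :=
  PowerSeries.X * W.clearedEval n φO * W.veluFormalUnit U₀ M₀ p n

variable {W}

/-- `X·ℳ` has constant term `1` (`M` monic of degree `3n`). [folklore] -/
theorem constantCoeff_formalXMulSq_mul_clearedEval {M₀ : 𝒪[X]} {n : ℕ} (hM : M₀.natDegree ≤ 3 * n)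
    (hM1 : M₀.coeff (3 * n) = 1) : constantCoeff (W.formalXMulSq * W.clearedEval (3 * n) M₀) = 1 := by
  rw [map_mul, W.constantCoeff_formalXMulSq, W.constantCoeff_clearedEval hM, hM1, one_mul]

/-- **`u·X·ℳ = 𝒰`** (the defining identity of `u`). [Blakestad–Grant 2023, Lemma 12] [folklore] -/
theorem veluFormalUnit_mul {U₀ M₀ : 𝒪[X]} {p n : ℕ} (hM : M₀.natDegree ≤ 3 * n) (hM1 : M₀.coeff (3 * n) = 1) :
    W.veluFormalUnit U₀ M₀ p n * (W.formalXMulSq * W.clearedEval (3 * n) M₀) = W.clearedEval p U₀ := by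
  rw [veluFormalUnit, mul_assoc, mul_comm (PowerSeries.invOfUnit _ _),
    PowerSeries.mul_invOfUnit _ _ (by rw [constantCoeff_formalXMulSq_mul_clearedEval hM hM1, Units.val_one]), mul_one]

/-- **`t_p·X·ℳ = t·Φ·𝒰`**, i.e. `t_p = -U(x)φ(x)/(yM(x))` at the formal point, cleared
(`y = -X/t³`). [Blakestad–Grant 2023, Prop. 7(c)] [cite: BlakestadGrant2023, Prop. 7] -/
theorem veluFormalIsog_mul {φO U₀ M₀ : 𝒪[X]} {p n : ℕ} (hM : M₀.natDegree ≤ 3 * n) (hM1 : M₀.coeff (3 * n) = 1) :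
    W.veluFormalIsog φO U₀ M₀ p n * (W.formalXMulSq * W.clearedEval (3 * n) M₀) =
      PowerSeries.X * W.clearedEval n φO * W.clearedEval p U₀ := by
  rw [veluFormalIsog, mul_assoc, veluFormalUnit_mul hM hM1]

/-- `t_p(0) = 0`. [folklore] -/
theorem constantCoeff_veluFormalIsog (φO U₀ M₀ : 𝒪[X]) (p n : ℕ) :
    constantCoeff (W.veluFormalIsog φO U₀ M₀ p n) = 0 := by
  rw [veluFormalIsog, mul_assoc, map_mul, constantCoeff_X, zero_mul]

/-- **The lead term `t_p = φₙ·U_p·t + ⋯`** (`= p·t` for `φ = pD`, `U` monic: `ψ^*ω_p = pω`).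
[Blakestad–Grant 2023, Prop. 7(c) ("the lead term of `t_{p/H}` is `pt/H` because
`ψ^*(ω_{p/H}) = (p/H)ω`")] [cite: BlakestadGrant2023, Prop. 7] -/
theorem coeff_one_veluFormalIsog {φO U₀ M₀ : 𝒪[X]} {p n : ℕ} (hφ : φO.natDegree ≤ n) (hU : U₀.natDegree ≤ p) :
    coeff 1 (W.veluFormalIsog φO U₀ M₀ p n) = φO.coeff n * U₀.coeff p := by
  rw [veluFormalIsog, mul_assoc, coeff_succ_X_mul, coeff_zero_eq_constantCoeff, map_mul, W.constantCoeff_clearedEval hφ,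
    veluFormalUnit, map_mul, W.constantCoeff_clearedEval hU, PowerSeries.constantCoeff_invOfUnit, inv_one,
    Units.val_one, mul_one]

/-- Congruences pass to cleared expansions: if `p ∣ gᵢ` for all `i` (`deg g ≤ d`) then all
coefficients of `ev_d(g)` are divisible by `p`. [folklore] -/
theorem map_clearedEval_eq_zero {p : 𝒪} {d : ℕ} {g : 𝒪[X]} (hg : g.natDegree ≤ d) (hdvd : ∀ i, p ∣ g.coeff i) :
    PowerSeries.map (Ideal.Quotient.mk (Ideal.span {p})) (W.clearedEval d g) = 0 := by
  ext i
  rw [PowerSeries.coeff_map, _root_.map_zero, Ideal.Quotient.eq_zero_iff_mem]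
  exact W.coeff_clearedEval_mem hg (fun k => Ideal.mem_span_singleton.mpr (hdvd k)) i

/-- **`u ≡ 1 (mod p)`** (Blakestad–Grant Lemma 12: "`u(t) ≡ 1 mod p`"): modulo `p`,
`𝒰 ≡ X^p` (`U ≡ x^p`), `ℳ ≡ X^{2n}` (`M ≡ f^n`, `t⁶f(x) = X²`), so `ū·X̄^{2n+1} = X̄^p` and `X̄`
is a unit of `(𝒪/p)⟦t⟧`. [Blakestad–Grant 2023, Lemma 12] [cite: BlakestadGrant2023, Lemma 12] -/
theorem map_veluFormalUnit_sub_one [W.IsShortNF] {p : ℕ} {n : ℕ} (hp : 2 * n + 1 = p) {U₀ M₀ : 𝒪[X]}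
    (hU : U₀.natDegree ≤ p) (hUp : ∀ i, (p : 𝒪) ∣ (U₀ - Polynomial.X ^ p).coeff i)
    (hM : M₀.natDegree ≤ 3 * n) (hM1 : M₀.coeff (3 * n) = 1)
    (hMp : ∀ i, (p : 𝒪) ∣ (M₀ - (Polynomial.X ^ 3 + Polynomial.C W.a₄ * Polynomial.X + Polynomial.C W.a₆) ^ n).coeff i) :
    PowerSeries.map (Ideal.Quotient.mk (Ideal.span {(p : 𝒪)})) (W.veluFormalUnit U₀ M₀ p n - 1) = 0 := by
  set mk := Ideal.Quotient.mk (Ideal.span {(p : 𝒪)}) with hmk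
  set Xs := W.formalXMulSq with hXs
  have hf : W.rhsCubic = Polynomial.X ^ 3 + Polynomial.C W.a₄ * Polynomial.X + Polynomial.C W.a₆ := by
    rw [rhsCubic, W.a₂_of_isShortNF, Polynomial.C_0, zero_mul, add_zero]
  -- `𝒰 ≡ Xs^p`, `ℳ ≡ Xs^{2n}`
  have hXp : (Polynomial.X ^ p : 𝒪[X]).natDegree ≤ p := Polynomial.natDegree_X_pow_le p
  have hU' : PowerSeries.map mk (W.clearedEval p U₀) = PowerSeries.map mk Xs ^ p := by
    have h := W.map_clearedEval_eq_zero (g := U₀ - Polynomial.X ^ p)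
      ((Polynomial.natDegree_sub_le _ _).trans (max_le hU hXp)) hUp
    rwa [clearedEval_sub, map_sub, sub_eq_zero, W.clearedEval_X_pow le_rfl, Nat.sub_self, mul_zero, pow_zero,
      mul_one, map_pow] at h
  have hfn : ((Polynomial.X ^ 3 + Polynomial.C W.a₄ * Polynomial.X + Polynomial.C W.a₆) ^ n : 𝒪[X]).natDegree ≤ 3 * n := by
    rw [← hf]
    exact Polynomial.natDegree_pow_le.trans ((Nat.mul_le_mul_left n W.natDegree_rhsCubic_le).trans (le_of_eq (mul_comm n 3)))
  have hM' : PowerSeries.map mk (W.clearedEval (3 * n) M₀) = PowerSeries.map mk Xs ^ (2 * n) := by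
    have h := W.map_clearedEval_eq_zero (g := M₀ - (Polynomial.X ^ 3 + Polynomial.C W.a₄ * Polynomial.X +
      Polynomial.C W.a₆) ^ n) ((Polynomial.natDegree_sub_le _ _).trans (max_le hM hfn)) hMp
    rwa [clearedEval_sub, map_sub, sub_eq_zero, ← hf, W.clearedEval_pow_rhsCubic, map_pow] at h
  -- `ū·X̄s^{2n+1} = X̄s^p`, and `X̄s` is a unit
  have hid := congrArg (PowerSeries.map mk) (veluFormalUnit_mul (W := W) (U₀ := U₀) (p := p) hM hM1)
  rw [map_mul, map_mul, hU', hM', ← hXs, ← pow_succ', hp] at hid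
  have hXsu : PowerSeries.map mk Xs ^ p * (PowerSeries.map mk Xs ^ p).invOfUnit 1 = 1 :=
    PowerSeries.mul_invOfUnit _ _ (by rw [map_pow, ← PowerSeries.coeff_zero_eq_constantCoeff, PowerSeries.coeff_map,
      PowerSeries.coeff_zero_eq_constantCoeff, hXs, W.constantCoeff_formalXMulSq, map_one, one_pow, Units.val_one])
  rw [map_sub, map_one]
  linear_combination (PowerSeries.map mk Xs ^ p).invOfUnit 1 * hid -
    (PowerSeries.map mk (W.veluFormalUnit U₀ M₀ p n) - 1) * hXsu

/-- **`t_p ≡ ℓ₀·t^p (mod p)`** (Blakestad–Grant Prop. 7(c): "`t_p ≡ Ht^p mod p`", `ℓ̃₀ ≡ H`):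
modulo `p`, `Φ ≡ ℓ₀t^{2n}` (`φ ≡ ℓ₀`) and `u ≡ 1`, so `t_p = tΦu ≡ ℓ₀t^{2n+1}`.
[Blakestad–Grant 2023, Prop. 7(c)] [cite: BlakestadGrant2023, Prop. 7] -/
theorem map_veluFormalIsog_sub [W.IsShortNF] {p : ℕ} {n : ℕ} (hp : 2 * n + 1 = p) {φO U₀ M₀ : 𝒪[X]}
    (hφ : φO.natDegree ≤ n) (hφp : ∀ i, 1 ≤ i → (p : 𝒪) ∣ φO.coeff i)
    (hU : U₀.natDegree ≤ p) (hUp : ∀ i, (p : 𝒪) ∣ (U₀ - Polynomial.X ^ p).coeff i)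
    (hM : M₀.natDegree ≤ 3 * n) (hM1 : M₀.coeff (3 * n) = 1)
    (hMp : ∀ i, (p : 𝒪) ∣ (M₀ - (Polynomial.X ^ 3 + Polynomial.C W.a₄ * Polynomial.X + Polynomial.C W.a₆) ^ n).coeff i) :
    PowerSeries.map (Ideal.Quotient.mk (Ideal.span {(p : 𝒪)}))
      (W.veluFormalIsog φO U₀ M₀ p n - PowerSeries.C (φO.coeff 0) * PowerSeries.X ^ p) = 0 := by
  set mk := Ideal.Quotient.mk (Ideal.span {(p : 𝒪)}) with hmk
  have hu := map_veluFormalUnit_sub_one (W := W) hp hU hUp hM hM1 hMp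
  rw [map_sub, map_one, sub_eq_zero] at hu
  -- `Φ ≡ ℓ₀t^{2n}`
  have hΦ : PowerSeries.map mk (W.clearedEval n φO) = PowerSeries.C (mk (φO.coeff 0)) * PowerSeries.X ^ (2 * n) := by
    have hdeg : (φO - Polynomial.C (φO.coeff 0)).natDegree ≤ n :=
      (Polynomial.natDegree_sub_le _ _).trans (max_le hφ (by rw [Polynomial.natDegree_C]; exact Nat.zero_le _))
    have hdvd : ∀ i, (p : 𝒪) ∣ (φO - Polynomial.C (φO.coeff 0)).coeff i := by
      intro i
      rw [Polynomial.coeff_sub, Polynomial.coeff_C]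
      split_ifs with hi
      · rw [hi, sub_self]; exact dvd_zero _
      · rw [sub_zero]; exact hφp i (Nat.one_le_iff_ne_zero.mpr hi)
    have h := W.map_clearedEval_eq_zero hdeg hdvd
    rwa [clearedEval_sub, map_sub, sub_eq_zero, show Polynomial.C (φO.coeff 0) = Polynomial.C (φO.coeff 0) *
      Polynomial.X ^ 0 by rw [pow_zero, mul_one], W.clearedEval_C_mul_X_pow (Nat.zero_le n), pow_zero, one_mul,
      Nat.sub_zero, map_mul, map_pow, PowerSeries.map_C, PowerSeries.map_X] at h
  rw [map_sub, veluFormalIsog, map_mul, map_mul, hu, hΦ, PowerSeries.map_X, mul_one, map_mul, map_pow,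
    PowerSeries.map_C, PowerSeries.map_X,
    show (PowerSeries.X ^ p : PowerSeries (𝒪 ⧸ Ideal.span {(p : 𝒪)})) = PowerSeries.X ^ (2 * n) * PowerSeries.X by
      rw [← pow_succ, hp]]
  ring

end FormalIsog

end WeierstrassCurve
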